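import Summits.ResolutionOfSingularities.ResolutionOfSingularities.Theorems.MarkedTransferCampaignW46MohWindowShadeAdapted
import Summits.ResolutionOfSingularities.ResolutionOfSingularities.Theorems.MarkedTransferCampaignW46MohWindowShadeRunFormula
import Summits.ResolutionOfSingularities.ResolutionOfSingularities.Theorems.MarkedTransferCampaignW46MohWindowShadeExit
import HarnessLib

/-!
# [OURS · L1 W4.6] Rung (iii) "Moh window", SURFACES — an infinite STALL walk in the Hauser–Wagner frame
  runs into the formal `p`-fold-curve case

Cell `res-hironaka`, rung L, slot W4.6 (restricted regimes as rungs), seat `res-L1-s46-pv-6` (gen 3).  The core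
of the TERMINATION half of the role of Th. 16.6 (2) / Th. 16.13 for the classical pair (order, shade) in regime
(iii) — purely inseparable `x^p + F`, `p ≤ ord F < 2p` at every stage — for SURFACES (two residual letters
`σ = {j, i}`), in the tree's transcription of [Hauser2010, §§F–G] (`PointBlowup.State/step/shade`,
`PointBlowupShade.lean`).  Gen 0: the shade never increases inside the window; gen 2: decrease laws, terminal
case, and the NEGATIVE boundary — in-window two-cycles and a fixed point for arbitrary point centres (`…Cycle`,
`…FixedPoint`, `…NoInvariant`), all sitting on a `p`-fold CURVE (`F = y·h^p`).  Here:

* `invariants_of_walk` — along an in-window walk of equimultiple points, cleanedness and `y^r ∣ F` persist and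
  `p < ord F_n < 2p` (the bottom edge carries no equimultiple point for surfaces, gen 2 `…Exit`);
* `exists_formal_curve_of_stall_walk` — along an infinite walk all of whose steps are STALLS, presented in the
  Hauser–Wagner frame (translated points read in the chart `y_j`; the origin of the chart `y_i` is the vertical
  move), some state is in the FORMAL `p`-FOLD-CURVE CASE to every order: `∀ m, F_n ≡ h^p · w` modulo degree
  `≥ m`, `h(0) = 0`, `dh(0) ≠ 0`.
Mechanism (all OURS, kernel-checked in the imports): shade `0` is gen 2's terminal case
(`…Terminal.length_le_of_noProperCentre`, else `y_l^p ∣ F`); for shade `A ≥ 1` a stall in the chart `y_j` makes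
the next state ADAPTED (`…Adapted`), after which the vertical move would drop the shade, so the chart `y_j`
persists; a translated stall kills `r_i`, whence `o_{n+1} + p = o_n + A`: only `A = p` survives, and then the RUN
FORMULA (`…RunFormula.exists_formal_pth_power_of_run`) exhibits `F ≡ (y_i − ψ(y_j))^p · w` to every order;
pure origin tails force `y_i^p ∣ F` / `y_j^p ∣ F` (`…Adapted.forall_le_sum_of_origin_run`).  The companion
`…MohWindowShadeTermination.lean` removes the stall hypothesis.  OURS; replaces — for regime (iii) of RESCUE-SEED
W4.6, the classical pair, surfaces — the ROLE of the termination clause of Th. 16.13 (ms. p. 87 l. 25–29); NOT a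
statement of the manuscript [claim: Hironaka2017, status: under-review], nothing of which is used.  AI review is
weaker than expert review.
-/

noncomputable section

set_option linter.dupNamespace false -- mandated namespace of this single-conjunct summit

open MvPolynomial Finset

namespace Summit.ResolutionOfSingularities.ResolutionOfSingularities.Theorems.CampaignW46.MohWindowShadeStallWalk

open Literature.AlgebraicGeometry.Resolution
open Literature.AlgebraicGeometry.Resolution.PointBlowup
open Literature.AlgebraicGeometry.Resolution.Hauser2010
open Literature.Barriers.ResolutionOfSingularities (ordZero_le_of_coeff_ne_zero le_ordZero_of_forall)
open MohWindowShadeCleaning (eq_single_add_single degree_eq_add)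

variable {σ : Type*} {K : Type*} [Field K] [Fintype σ] [DecidableEq σ] [DecidableEq K]
variable (p : ℕ) [hp : Fact p.Prime] [CharP K p]

/-! ## §1. Small tools -/

omit [Fintype σ] [DecidableEq K] hp [CharP K p] in
/-- A residual polynomial all of whose monomials are divisible by `y_l^p` is `y_l^p · w`: the coordinate
`p`-fold curve `y_l = 0`, in the formal `p`-fold-curve form to every order. [folklore] -/
theorem exists_formal_curve_of_forall_le {F : MvPolynomial σ K} {l : σ}
    (h : ∀ d ∈ F.support, p ≤ d l) (m : ℕ) :
    ∃ h w : MvPolynomial σ K, coeff 0 h = 0 ∧ (∃ l', coeff (Finsupp.single l' 1) h ≠ 0) ∧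
      (m : ℕ∞) ≤ ordZero (F - h ^ p * w) := by
  classical
  refine ⟨X l, ∑ d ∈ F.support, monomial (d - Finsupp.single l p) (coeff d F), ?_, ⟨l, ?_⟩, ?_⟩
  · rw [coeff_X, if_neg (Finsupp.single_ne_zero.mpr one_ne_zero)]
  · rw [coeff_X, if_pos rfl]; exact one_ne_zero
  · have hF : X l ^ p * ∑ d ∈ F.support, monomial (d - Finsupp.single l p) (coeff d F) = F := by
      rw [Finset.mul_sum]
      have h1 : ∀ d ∈ F.support,
          X l ^ p * monomial (d - Finsupp.single l p) (coeff d F) = monomial d (coeff d F) := by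
        intro d hd
        rw [← monomial_single_add, add_tsub_cancel_of_le (Finsupp.single_le_iff.mpr (h d hd))]
      rw [Finset.sum_congr rfl h1]
      exact F.as_sum.symm
    rw [hF, sub_self]
    unfold ordZero
    simp

omit [DecidableEq σ] [DecidableEq K] hp [CharP K p] in
/-- The order of a state is at least `|r|` when `y^r ∣ F`. [folklore] -/
theorem degree_r_le (s : State σ K) {o : ℕ} (ho : ordZero s.F = o)
    (hr : ∀ d ∈ s.F.support, s.r ≤ d) : s.r.degree ≤ o := by
  obtain ⟨⟨d₀, hd₀, hd₀deg⟩, -⟩ := (ordZero_eq_nat_iff _ _).mp ho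
  exact hd₀deg ▸ degree_le_degree_of_le (hr d₀ (MvPolynomial.mem_support_iff.mpr hd₀))

section TwoLetters

variable {j i : σ}

omit hp [CharP K p] in
/-- Two letters: the total new multiplicity after a step in the chart `y_j` at `b` (`b_j = 0`):
`|r'| = (o − p) + (r_i if b_i = 0, else 0)`. [folklore] -/
theorem degree_step_r (hij : i ≠ j) (htwo : ∀ l, l = j ∨ l = i) (b : σ → K) (hbj : b j = 0)
    (s : State σ K) {o : ℕ} (ho : ordZero s.F = o) :
    (step p j b s).r.degree = (o - p) + (if b i = 0 then s.r i else 0) := by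
  rw [degree_eq_add hij htwo, MohWindowShadeTerminal.step_r_apply p j b hbj s ho j,
    MohWindowShadeTerminal.step_r_apply p j b hbj s ho i, if_pos hbj, if_pos rfl, if_neg hij]

omit [DecidableEq K] hp [CharP K p] in
/-- Two letters: the other indices of `j` are `{i}`. [folklore] -/
theorem univ_erase_eq_singleton (hij : i ≠ j) (htwo : ∀ l, l = j ∨ l = i) :
    (Finset.univ : Finset σ).erase j = {i} := by
  classical
  ext l
  rw [Finset.mem_erase, Finset.mem_singleton]
  constructor
  · rintro ⟨hlj, -⟩
    rcases htwo l with h | h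
    · exact absurd h hlj
    · exact h
  · intro h; rw [h]; exact ⟨hij, Finset.mem_univ i⟩

/-! ## §2. The invariants of an in-window walk (surfaces) -/

/-- **[OURS · L1 W4.6] Invariants along an in-window walk of equimultiple points (surfaces).**  Cleanedness and
`y^r ∣ F` persist, and the order is a natural number STRICTLY between `p` and `2p` at every stage: the bottom
edge `ord F = p` carries no equimultiple point for surfaces (gen 2, `…Exit.not_isEquimultiplePoint_of_two_vars`),
so an infinite walk never visits it.  NOT a statement of the manuscript. [folklore] -/
theorem invariants_of_walk (hij : i ≠ j) (htwo : ∀ l, l = j ∨ l = i) (s : ℕ → State σ K) (c : ℕ → σ)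
    (b : ℕ → σ → K) (hb : ∀ n, b n (c n) = 0) (hstep : ∀ n, s (n + 1) = step p (c n) (b n) (s n))
    (hclean : deletePthPowers p (s 0).F = (s 0).F) (hr : ∀ d ∈ (s 0).F.support, (s 0).r ≤ d)
    (heq : ∀ n, IsEquimultiplePoint p (c n) (b n) (s n))
    (hwin : ∀ n, (p : ℕ∞) ≤ ordZero (s n).F ∧ ordZero (s n).F < (2 * p : ℕ)) (n : ℕ) :
    deletePthPowers p (s n).F = (s n).F ∧ (∀ d ∈ (s n).F.support, (s n).r ≤ d) ∧
      ∃ o : ℕ, ordZero (s n).F = o ∧ p < o ∧ o < 2 * p := by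
  have hinv : ∀ n, deletePthPowers p (s n).F = (s n).F ∧ ∀ d ∈ (s n).F.support, (s n).r ≤ d := by
    intro n
    induction n with
    | zero => exact ⟨hclean, hr⟩
    | succ n ih =>
      obtain ⟨-, ih2⟩ := ih
      have hne : ordZero (s n).F ≠ ⊤ := ne_top_of_lt (hwin n).2
      obtain ⟨o, ho'⟩ := WithTop.ne_top_iff_exists.mp hne
      rw [hstep n]
      exact ⟨deletePthPowers_step p (c n) (b n) (s n),
        newMult_le_of_mem_support_step p (c n) (b n) (hb n) (s n) ho'.symm ih2⟩
  refine ⟨(hinv n).1, (hinv n).2, ?_⟩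
  have hne : ordZero (s n).F ≠ ⊤ := ne_top_of_lt (hwin n).2
  obtain ⟨o, ho'⟩ := WithTop.ne_top_iff_exists.mp hne
  have ho : ordZero (s n).F = o := ho'.symm
  have hpo : p ≤ o := by have := (hwin n).1; rw [ho] at this; exact_mod_cast this
  have ho2 : o < 2 * p := by have := (hwin n).2; rw [ho] at this; exact_mod_cast this
  refine ⟨o, ho, ?_, ho2⟩
  rcases hpo.lt_or_eq with h | h
  · exact h
  · exfalso
    rcases htwo (c n) with hc | hc
    · have hbj : b n j = 0 := by rw [← hc]; exact hb n
      have heq' : IsEquimultiplePoint p j (b n) (s n) := by rw [← hc]; exact heq n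
      exact MohWindowShadeExit.not_isEquimultiplePoint_of_two_vars p hij htwo (b n) hbj (s n)
        (hinv n).1 (by rw [ho, h]) heq'
    · have htwo' : ∀ l, l = i ∨ l = j := fun l => (htwo l).symm
      have hbi : b n i = 0 := by rw [← hc]; exact hb n
      have heq' : IsEquimultiplePoint p i (b n) (s n) := by rw [← hc]; exact heq n
      exact MohWindowShadeExit.not_isEquimultiplePoint_of_two_vars p hij.symm htwo' (b n) hbi (s n)
        (hinv n).1 (by rw [ho, h]) heq'

/-! ## §3. Walks all of whose steps are stalls -/

/-- **[OURS · L1 W4.6] SURFACES: AN INFINITE STALL WALK IN THE HAUSER–WAGNER FRAME MEETS THE FORMAL `p`-FOLD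
CURVE.**  Let `s₀, s₁, …` be an infinite walk `s_{n+1} = step p (c n) (b n) (s n)` of point blow-ups of the
surface `x^p + F(y_j, y_i)` presented in the Hauser–Wagner frame — chart `c n ∈ {j, i}`, point `b n` with
`b n (c n) = 0`, and `b n = 0` whenever `c n = i` (translated points are read in the chart `y_j`) — from a
cleaned state with `y^r ∣ F`, every step EQUIMULTIPLE, every state inside the window `p ≤ ord F_n < 2p`, and
suppose NO step drops the shade.  Then some state `s_n` is in the formal `p`-fold-curve case to every order:
for every `m` there are polynomials `h, w` with `h(0) = 0`, some `∂h/∂y_l(0) ≠ 0`, and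
`ord(F_n − h^p·w) ≥ m`.  NOT a statement of the manuscript. [folklore] -/
theorem exists_formal_curve_of_stall_walk (hij : i ≠ j) (htwo : ∀ l, l = j ∨ l = i) (s : ℕ → State σ K)
    (c : ℕ → σ) (b : ℕ → σ → K) (hb : ∀ n, b n (c n) = 0) (hHW : ∀ n, c n = i → ∀ l, b n l = 0)
    (hstep : ∀ n, s (n + 1) = step p (c n) (b n) (s n))
    (hclean : deletePthPowers p (s 0).F = (s 0).F) (hr : ∀ d ∈ (s 0).F.support, (s 0).r ≤ d)
    (heq : ∀ n, IsEquimultiplePoint p (c n) (b n) (s n))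
    (hwin : ∀ n, (p : ℕ∞) ≤ ordZero (s n).F ∧ ordZero (s n).F < (2 * p : ℕ))
    (hstall : ∀ n, ¬ ShadeDrops p (c n) (b n) (s n)) :
    ∃ n, ∀ m : ℕ, ∃ h w : MvPolynomial σ K, coeff 0 h = 0 ∧ (∃ l, coeff (Finsupp.single l 1) h ≠ 0) ∧
      (m : ℕ∞) ≤ ordZero ((s n).F - h ^ p * w) := by
  classical
  -- §a invariants
  have hinv := invariants_of_walk p hij htwo s c b hb hstep hclean hr heq hwin
  choose o ho hlo hhi using fun n => (hinv n).2.2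
  have hcl : ∀ n, deletePthPowers p (s n).F = (s n).F := fun n => (hinv n).1
  have hrn : ∀ n, ∀ d ∈ (s n).F.support, (s n).r ≤ d := fun n => (hinv n).2.1
  have hrle : ∀ n, (s n).r.degree ≤ o n := fun n => degree_r_le (s n) (ho n) (hrn n)
  have hdeg : ∀ n, ∀ d ∈ (s n).F.support, p ≤ d.degree :=
    fun n d hd => le_trans (hlo n).le (le_degree_of_ordZero_eq (s n) (ho n) d hd)
  have hstepj : ∀ n, c n = j → s (n + 1) = step p j (b n) (s n) := fun n h => by rw [hstep n, h]
  have hbj' : ∀ n, c n = j → b n j = 0 := fun n h => by rw [← h]; exact hb n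
  -- §b the constant shade `A`: `o n = |r n| + A`
  have hshade : ∀ n, (s n).shade = ((o n - (s n).r.degree : ℕ) : ℕ∞) :=
    fun n => shade_eq_of_ordZero_eq (s n) (ho n)
  have hconst : ∀ n, o (n + 1) - (s (n + 1)).r.degree = o n - (s n).r.degree := by
    intro n
    have hle : (s (n + 1)).shade ≤ (s n).shade := by
      rw [hstep n]
      exact MohWindowShade.shade_step_le_of_lt_two_mul p (c n) (b n) (hb n) (s n) (hcl n) (ho n)
        (hlo n).le (hhi n) (hrn n) (heq n)
    have hge : ¬ (s (n + 1)).shade < (s n).shade := by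
      have := hstall n
      unfold ShadeDrops at this
      rwa [← hstep n] at this
    have heq' : (s (n + 1)).shade = (s n).shade := le_antisymm hle (not_lt.mp hge)
    rw [hshade, hshade] at heq'
    exact_mod_cast heq'
  set A := o 0 - (s 0).r.degree with hA
  have hA' : ∀ n, o n = (s n).r.degree + A := by
    intro n
    induction n with
    | zero => have := hrle 0; omega
    | succ n ih => have := hconst n; have := hrle (n + 1); have := hrle n; omega
  by_cases hA0 : A = 0
  · -- §c shade zero: the terminal case of gen 2
    by_cases hprop : ∃ l, p ≤ (s 0).r l
    · obtain ⟨l, hl⟩ := hprop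
      exact ⟨0, fun m => exists_formal_curve_of_forall_le p
        (fun d hd => le_trans hl (Finsupp.le_def.mp (hr d hd) l)) m⟩
    · push Not at hprop
      exfalso
      have hnpc : ∀ k, ∑ l ∈ univ.erase k, (s 0).r l < p := by
        intro k
        rcases htwo k with hk | hk
        · rw [hk, univ_erase_eq_singleton hij htwo, Finset.sum_singleton]; exact hprop i
        · have htwo' : ∀ l, l = i ∨ l = j := fun l => (htwo l).symm
          rw [hk, univ_erase_eq_singleton hij.symm htwo', Finset.sum_singleton]; exact hprop j
      have hordr : ordZero (s 0).F = ((s 0).r.degree : ℕ) := by rw [ho 0, hA' 0, hA0, add_zero]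
      have hlo0 : p < (s 0).r.degree := by have := hlo 0; rw [hA' 0, hA0] at this; omega
      have hhi0 : (s 0).r.degree < 2 * p := by have := hhi 0; rw [hA' 0, hA0] at this; omega
      have h := MohWindowShadeTerminal.length_le_of_noProperCentre p s c b hb hstep hclean hr hordr hlo0
        hhi0 hnpc (N := (s 0).r.degree) (fun n _ => heq n)
      omega
  · -- §d positive shade
    have hApos : 1 ≤ A := Nat.one_le_iff_ne_zero.mpr hA0
    -- a stall in the chart `y_j` makes the next state adapted
    have hadapt : ∀ n, c n = j →
        ∃ E ∈ (s (n + 1)).F.support, E.degree = o (n + 1) ∧ (s (n + 1)).r i < E i := by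
      intro n hcn
      have hstalln : ¬ ShadeDrops p j (b n) (s n) := by
        have := hstall n; rw [hcn] at this; exact this
      have hAn : o n - (s n).r.degree = A := by have := hA' n; omega
      by_cases hbi : b n i = 0
      · have hb0 : ∀ l, b n l = 0 := fun l => by
          rcases htwo l with rfl | rfl
          · exact hbj' n hcn
          · exact hbi
        obtain ⟨E, hE, hEj, hEi⟩ := MohWindowShadeAdapted.exists_adapted_of_stall_origin p hij htwo (b n)
          hb0 (s n) (hcl n) (ho n) (hlo n) (hhi n) (hrn n) hstalln
        rw [← hstepj n hcn] at hE hEj hEi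
        refine ⟨E, hE, ?_, ?_⟩
        · rw [degree_eq_add hij htwo E, hEj, hEi, hA' (n + 1),
            degree_eq_add hij htwo (s (n + 1)).r, hAn]
          ring
        · rw [hEi, hAn]; omega
      · have hE := MohWindowShadeAdapted.mem_support_step_of_stall_translate p hij htwo (b n)
          (hbj' n hcn) hbi (s n) (ho n) (hlo n) (hhi n) (hrn n) hstalln
        rw [← hstepj n hcn] at hE
        have hr' : (s (n + 1)).r.degree = o n - p := by
          rw [hstepj n hcn, degree_step_r p hij htwo (b n) (hbj' n hcn) (s n) (ho n), if_neg hbi,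
            add_zero]
        have hri' : (s (n + 1)).r i = 0 := by
          rw [hstepj n hcn, MohWindowShadeTerminal.step_r_apply p j (b n) (hbj' n hcn) (s n) (ho n) i,
            if_neg hbi]
        refine ⟨_, hE, ?_, ?_⟩
        · rw [map_add, Finsupp.degree_single, Finsupp.degree_single, hA' (n + 1), hr', hAn]
        · rw [hri', Finsupp.add_apply, Finsupp.single_eq_of_ne hij, Finsupp.single_eq_same, zero_add,
            hAn]
          omega
    -- no vertical stall from an adapted state
    have hnoV : ∀ n, (∃ E ∈ (s n).F.support, E.degree = o n ∧ (s n).r i < E i) → c n = j := by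
      rintro n ⟨E, hE, hEdeg, hEi⟩
      rcases htwo (c n) with h | h
      · exact h
      · exfalso
        have hb0 : b n = 0 := funext (hHW n h)
        have hdrop := MohWindowShadeAdapted.shadeDrops_vertical_of_adapted p (s n) (ho n) (hlo n)
          (hhi n) (hrn n) hE hEdeg hEi
        apply hstall n
        rw [h, hb0]
        exact hdrop
    -- persistence of the chart `y_j`
    have hpers : ∀ n, c n = j → ∀ k, c (n + k) = j := by
      intro n hcn k
      induction k with
      | zero => rw [add_zero]; exact hcn
      | succ k ih => exact hnoV (n + k + 1) (hadapt (n + k) ih)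
    by_cases hI : ∃ n₁, c n₁ = j
    · obtain ⟨n₁, hn₁⟩ := hI
      have hcj : ∀ n, n₁ ≤ n → c n = j := by
        intro n hn
        obtain ⟨k, rfl⟩ := Nat.exists_eq_add_of_le hn
        exact hpers n₁ hn₁ k
      by_cases hIa : ∃ n₂, n₁ ≤ n₂ ∧ b n₂ i ≠ 0
      · -- §e a translated stall at `n₂`: afterwards `r_i = 0` and `o_{n+1} + p = o_n + A`
        obtain ⟨n₂, hn₁₂, hbn₂⟩ := hIa
        have hri : ∀ k, (s (n₂ + 1 + k)).r i = 0 := by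
          intro k
          induction k with
          | zero =>
            rw [add_zero, hstepj n₂ (hcj n₂ hn₁₂), MohWindowShadeTerminal.step_r_apply p j (b n₂)
              (hbj' n₂ (hcj n₂ hn₁₂)) (s n₂) (ho n₂) i, if_neg hbn₂]
          | succ k ih =>
            have hc' : c (n₂ + 1 + k) = j := hcj _ (by omega)
            rw [show n₂ + 1 + (k + 1) = n₂ + 1 + k + 1 by omega, hstepj _ hc',
              MohWindowShadeTerminal.step_r_apply p j (b _) (hbj' _ hc') (s _) (ho _) i, if_neg hij, ih]
            split_ifs <;> rfl
        have hodyn : ∀ k, o (n₂ + 1 + k + 1) + p = o (n₂ + 1 + k) + A := by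
          intro k
          have hc' : c (n₂ + 1 + k) = j := hcj _ (by omega)
          have h1 := hA' (n₂ + 1 + k + 1)
          have h2 : (s (n₂ + 1 + k + 1)).r.degree = o (n₂ + 1 + k) - p := by
            rw [hstepj _ hc', degree_step_r p hij htwo (b _) (hbj' _ hc') (s _) (ho _), hri k]
            split_ifs <;> rfl
          have h3 := hlo (n₂ + 1 + k)
          omega
        rcases Nat.lt_trichotomy A p with hAp | hAp | hAp
        · -- `A < p`: the order decreases for ever
          exfalso
          have hdec : ∀ k, o (n₂ + 1 + k) + k ≤ o (n₂ + 1) := by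
            intro k
            induction k with
            | zero => rw [add_zero, add_zero]
            | succ k ih =>
              have := hodyn k
              rw [show n₂ + 1 + (k + 1) = n₂ + 1 + k + 1 by omega]
              omega
          have := hdec (o (n₂ + 1) + 1)
          omega
        · -- `A = p`: the run formula
          refine ⟨n₂ + 1, fun m => ?_⟩
          have hO : ∀ k, o (n₂ + 1 + k) = o (n₂ + 1) := by
            intro k
            induction k with
            | zero => rw [add_zero]
            | succ k ih =>
              have := hodyn k
              rw [show n₂ + 1 + (k + 1) = n₂ + 1 + k + 1 by omega]
              omega
          obtain ⟨h, w, hh0, hh1, hord'⟩ :=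
            MohWindowShadeRunFormula.exists_formal_pth_power_of_run p hij htwo (fun k => s (n₂ + 1 + k))
              (fun k => b (n₂ + 1 + k)) (fun k => hbj' _ (hcj _ (by omega)))
              (fun k => by
                show s (n₂ + 1 + (k + 1)) = step p j (b (n₂ + 1 + k)) (s (n₂ + 1 + k))
                rw [show n₂ + 1 + (k + 1) = n₂ + 1 + k + 1 by omega]
                exact hstepj _ (hcj _ (by omega)))
              (hcl (n₂ + 1)) (fun k => hdeg (n₂ + 1 + k)) m (o := o (n₂ + 1))
              (fun d hd => by
                have := le_degree_of_ordZero_eq (s (n₂ + 1 + m)) (ho _) d hd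
                rwa [hO m] at this)
          refine ⟨h, w, hh0, ⟨i, by rw [hh1]; exact one_ne_zero⟩, le_trans ?_ hord'⟩
          exact_mod_cast (Nat.le_add_left m (o (n₂ + 1)))
        · -- `p < A`: the order increases for ever, against the window
          exfalso
          have hinc : ∀ k, o (n₂ + 1) + k ≤ o (n₂ + 1 + k) := by
            intro k
            induction k with
            | zero => rw [add_zero, add_zero]
            | succ k ih =>
              have := hodyn k
              rw [show n₂ + 1 + (k + 1) = n₂ + 1 + k + 1 by omega]
              omega
          have h1 := hinc (2 * p)
          have h2 := hhi (n₂ + 1 + 2 * p)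
          omega
      · -- §f no translated move after `n₁`: an origin run in the chart `y_j`
        push Not at hIa
        refine ⟨n₁, fun m => ?_⟩
        have hb0 : ∀ n, n₁ ≤ n → b n = 0 := fun n hn => funext fun l => by
          rcases htwo l with rfl | rfl
          · exact hbj' n (hcj n hn)
          · exact hIa n hn
        have hrun := MohWindowShadeAdapted.forall_le_sum_of_origin_run p j (fun k => s (n₁ + k))
          (fun k => by
            show s (n₁ + (k + 1)) = step p j 0 (s (n₁ + k))
            rw [show n₁ + (k + 1) = n₁ + k + 1 by omega, hstep, hcj _ (by omega), hb0 _ (by omega)])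
          (hcl n₁) (fun k => hdeg (n₁ + k))
        refine exists_formal_curve_of_forall_le p (l := i) (fun d hd => ?_) m
        have := hrun d hd
        rwa [univ_erase_eq_singleton hij htwo, Finset.sum_singleton] at this
    · -- §g every move is vertical: an origin run in the chart `y_i` from the start
      push Not at hI
      have hci : ∀ n, c n = i := fun n => by
        rcases htwo (c n) with h | h
        · exact absurd h (hI n)
        · exact h
      have hb0 : ∀ n, b n = 0 := fun n => funext (hHW n (hci n))
      refine ⟨0, fun m => ?_⟩
      have hrun := MohWindowShadeAdapted.forall_le_sum_of_origin_run p i s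
        (fun n => by rw [hstep n, hci n, hb0 n]) hclean hdeg
      refine exists_formal_curve_of_forall_le p (l := j) (fun d hd => ?_) m
      have := hrun d hd
      have htwo' : ∀ l, l = i ∨ l = j := fun l => (htwo l).symm
      rwa [univ_erase_eq_singleton hij.symm htwo', Finset.sum_singleton] at this

end TwoLetters

end Summit.ResolutionOfSingularities.ResolutionOfSingularities.Theorems.CampaignW46.MohWindowShadeStallWalk
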